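import Literature.NumberTheory.GaloisRepresentations.HOneRepTrivialFamilies
import HarnessLib

/-!
# Unbounded order of the `E₂^{1,1}`-classes `[ḡ ↦ χ_i(ḡ) · [f_i]]` from a Lemma 2.7 (ii)-type datum

Let `G` be a profinite group, `N ⊴ G` closed, and let `K ≤ N` be a subgroup, normal in `G`, with
`[G, N] ⊆ K` (i.e. `G` acts TRIVIALLY by conjugation on `N/K`).  Suppose the conjugation-invariant
continuous homomorphisms `K → ℤ/lⁱ` are killed by one `l^c` for all `i` (print: "no nonzero
torsion-free subquotient of `Ker(T ↠ R)` on which `G_k` acts through a finite quotient",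
[AbsTopI] Lemma 2.7 (ii)(c), gives finiteness of the `G`-coinvariants of the kernel, whence such a
uniform `c`).  Then for continuous homomorphisms `f_i : N → ℤ/lⁱ` killing `K` and taking the value `1`
(the reductions of a primitive `G`-invariant `ℤ_l`-valued functional "`r^∨ ∘ π`" on `N ↠ N/K ⊇ R`),
and characters `χ_i : G/N → ℤ/lⁱ` taking the value `1` (reductions of a primitive unramified
`ℤ_l`-character), the classes `z_i = [ḡ ↦ χ_i(ḡ) · [f_i]] ∈ H¹(G/N, H¹(N, ℤ/lⁱ))`
(`hOneRepSmulClass`, `HOneRepTrivialFamilies.lean`) satisfy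

  `n • z_i = 0  ⟹  lⁱ ∣ l^c · n`      (`pow_dvd_of_nsmul_hOneRepSmulClass_eq_zero`),

so their orders are UNBOUNDED (`exists_nsmul_hOneRepSmulClass_ne_zero`): the hypothesis `hord` of
`one_le_deltaInv_two_of_hOneRep_family(_of_isOpen)`.  This is the finite-level form of the argument of
[AbsTopI] Lemma 2.7 (iii) (S. Mochizuki, *Topics in Absolute Anabelian Geometry I*, p. 25: "the long
exact cohomology sequence associated to `0 → Hom(R, Ẑ) → Hom(T(B), Ẑ) → Hom(N, Ẑ) → 0` [...]
`H⁰(G_k, Hom(N, Ẑ)) = 0`") as used on p. 23: a coboundary `ḡ ↦ ḡ·v − v` equal to `n χ_i ⊗ f_i`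
has `v|_K` conjugation-invariant (since `f_i` kills `K`), hence `l^c v` kills `K`, hence
`l^c (ḡ·v − v) = 0` (as `[G, N] ⊆ K`), hence `l^c n χ_i ⊗ f_i = 0`.

Together with `HOneRepTrivialFamilies.lean` (construction + compatibility) and
`AbsTopILem27HSEdgeMLF.lean` (the edge with its `G_K` inputs discharged) this makes the NON-SPLIT
Hochschild–Serre route to the conclusion `1 ≤ δ²_l(J)` of `FundamentalExtension.Lem27iiiStep` depend
on the group-theoretic Lemma 2.7 (ii) datum alone (`one_le_deltaInv_two_of_lem27Datum` in the
companion assembly).  Classical; nothing here bears on [IUTchIII] Cor. 3.12.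

## References
* S. Mochizuki, *Topics in Absolute Anabelian Geometry I* (2012), Lemma 2.7 (iii) p. 25 and the proof
  of Thm 2.6 (iii) p. 23. [MochizukiAbsTopI2012]
* J.-P. Serre, *Galois Cohomology* (1997), I §2.3, §2.6. [SerreGaloisCohomology1997]
-/

noncomputable section

open CategoryTheory ContinuousCohomology Function

namespace Literature.NumberTheory.GaloisRepresentations

open _root_.TopRep _root_.Topology _root_.Filter
open Literature.NumberTheory.EllipticCurves (subgroupConj subgroupConj_apply_coe)

variable {G : Type} [Group G] [TopologicalSpace G] [IsTopologicalGroup G] [CompactSpace G] [T2Space G]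
  [TotallyDisconnectedSpace G]
variable (N : Subgroup G) [N.Normal] [hN : IsClosed (N : Set G)]
variable {A : Type} [AddCommGroup A] [TopologicalSpace A] [DiscreteTopology A]

/-! ### Scalars and coboundaries in `H¹(N, A)` for trivial coefficients -/

omit [CompactSpace G] [T2Space G] [TotallyDisconnectedSpace G] [N.Normal] hN in
/-- `[k • f] = k • [f]` in `H¹(N, A)` (carrier `HOne`), `k ∈ ℕ`. [cite: SerreGaloisCohomology1997, I §2.3] -/
theorem hOneOf_nsmul (k : ℕ)
    (f : contOneCocycles (((ContinuousRep.trivial G ℤ A).restrict (subgroupIncl N)).toTopRep)) :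
    hOneOf N (k • f) = k • hOneOf N f := by
  have e : oneCocycleClass _ (k • f) = k • oneCocycleClass _ f := map_nsmul (oneCocycleClassₗ _) k f
  rw [hOneOf, hOneOf, e, map_nsmul]

omit [CompactSpace G] [T2Space G] [TotallyDisconnectedSpace G] [N.Normal] hN in
/-- `[f - f'] = [f] - [f']` in `H¹(N, A)` (carrier `HOne`). [cite: SerreGaloisCohomology1997, I §2.3] -/
theorem hOneOf_sub
    (f f' : contOneCocycles (((ContinuousRep.trivial G ℤ A).restrict (subgroupIncl N)).toTopRep)) :
    hOneOf N (f - f') = hOneOf N f - hOneOf N f' := by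
  rw [hOneOf, hOneOf, hOneOf, oneCocycleClass_sub, map_sub]

omit [T2Space G] in
/-- **The `G/N`-action on `[f] ∈ H¹(N, A)` is conjugation**: `ḡ · [f] = [n ↦ f(g⁻¹ n g)]`.
[cite: SerreGaloisCohomology1997, I §2.6] -/
theorem hOneRep_mk_hOneOf (g : G)
    (f : contOneCocycles (((ContinuousRep.trivial G ℤ A).restrict (subgroupIncl N)).toTopRep)) :
    hOneRep N (ContinuousRep.trivial G ℤ A) (QuotientGroup.mk g) (hOneOf N f) =
      hOneOf N (contOneCocycles.pullback (subgroupConj N g)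
        (conjRepHom (ContinuousRep.trivial G ℤ A).toTopRep N g) f :
          contOneCocycles (((ContinuousRep.trivial G ℤ A).restrict (subgroupIncl N)).toTopRep)) := by
  rw [hOneRep_mk_apply, hOneOf, AddEquiv.symm_apply_apply]
  have e : conjMap (ContinuousRep.trivial G ℤ A).toTopRep N g 1 (oneCocycleClass _ f) =
      oneCocycleClass _ (contOneCocycles.pullback (subgroupConj N g)
        (conjRepHom (ContinuousRep.trivial G ℤ A).toTopRep N g) f) :=
    map_oneCocycleClass _ _ _ _
  exact congrArg _ e

omit [CompactSpace G] [T2Space G] [TotallyDisconnectedSpace G] [N.Normal] hN in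
/-- Every element of `H¹(N, A)` (carrier `HOne`) is the class of a continuous homomorphism.
[cite: SerreGaloisCohomology1997, I §2.3] -/
theorem hOneOf_surjective : Surjective (hOneOf (G := G) N (A := A)) := fun v => by
  obtain ⟨f, hf⟩ := oneCocycleClass_surjective _ ((HOne.of N (ContinuousRep.trivial G ℤ A)).symm v)
  exact ⟨f, by rw [hOneOf, hf, AddEquiv.apply_symm_apply]⟩

omit [CompactSpace G] [T2Space G] [TotallyDisconnectedSpace G] [N.Normal] hN in
/-- `torsionSmulHom n y` on a natural number cast: `(k : ℤ/n) · y = k • y`.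
[cite: SerreGaloisCohomology1997, I §2.3] -/
theorem torsionSmulHom_natCast {V : Type} [AddCommGroup V] (n : ℕ) (y : V) (hny : n • y = 0) (k : ℕ) :
    torsionSmulHom n y hny (k : ZMod n) = k • y := by
  rw [← Int.cast_natCast, torsionSmulHom_intCast, natCast_zsmul]

/-! ### The order bound -/

section Order

variable (l : ℕ) [hl : Fact l.Prime]

omit [T2Space G] in
/-- **`n • z_i = 0 ⟹ lⁱ ∣ l^c · n`** for the class `z_i = [ḡ ↦ χ_i(ḡ) · [f_i]] ∈ H¹(G/N, H¹(N, ℤ/lⁱ))`,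
given: `K ≤ N` normal in `G` with `[G, N] ⊆ K`; every conjugation-invariant continuous homomorphism
`K → ℤ/lⁱ` killed by `l^c`; `f_i` killing `K` with `f_i(n₁) = 1`; `χ_i(q₁) = 1`.  (Finite-level
[AbsTopI] Lemma 2.7 (iii): a coboundary `ḡ·v − v` equal to `n χ_i ⊗ f_i` has `v|_K` invariant, so
`l^c v|_K = 0`, so `l^c (ḡ·v − v) = 0`, so `l^c n = 0` in `ℤ/lⁱ`.)
[cite: MochizukiAbsTopI2012, Lemma 2.7 (iii) p.24] -/
theorem pow_dvd_of_nsmul_hOneRepSmulClass_eq_zero (i : ℕ) (K : Subgroup G) [K.Normal] (hKN : K ≤ N)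
    (hGK : ∀ (g : G) (n : G), n ∈ N → n⁻¹ * (g⁻¹ * n * g) ∈ K) (c : ℕ)
    (hK : ∀ u : contOneCocycles
        (((ContinuousRep.trivial G ℤ (ZMod (l ^ i))).restrict (subgroupIncl K)).toTopRep),
      (∀ (g : G) (k : K), u.1 (subgroupConj K g k) = u.1 k) → l ^ c • u = 0)
    (χ : contOneCocycles (ContinuousRep.trivial (G ⧸ N) ℤ (ZMod (l ^ i))).toTopRep)
    (hχ1 : ∃ q, χ.1 q = 1)
    (f : contOneCocycles (((ContinuousRep.trivial G ℤ (ZMod (l ^ i))).restrict (subgroupIncl N)).toTopRep))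
    (hf : ∀ (g : G) (n : N), f.1 (subgroupConj N g n) = f.1 n)
    (hfK : ∀ n : N, (n : G) ∈ K → f.1 n = 0) (hf1 : ∃ n : N, f.1 n = 1)
    {n : ℕ} (hz : n • hOneRepSmulClass N l i χ f hf = 0) : l ^ i ∣ l ^ c * n := by
  classical
  haveI : NeZero (l ^ i) := ⟨pow_ne_zero i hl.out.ne_zero⟩
  -- the class `n • z` is the class of the cocycle `n • (χ · [f])`, which is a coboundary `q ↦ q v - v`
  have h0 : oneCocycleClass _ (n • smulCocycle (hOneRep N (ContinuousRep.trivial G ℤ (ZMod (l ^ i))))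
      χ (hOneOf N f) (hOneOf_mem_invariants N f hf)
      (nsmul_hOneOf_eq_zero N (fun a => by rw [nsmul_eq_mul, ZMod.natCast_self, zero_mul]) f)) = 0 := by
    refine Eq.trans (map_nsmul (oneCocycleClassₗ _) n _) ?_
    exact hz
  obtain ⟨v, hv⟩ := (oneCocycleClass_eq_zero_iff _ _).1 h0
  obtain ⟨w, rfl⟩ := hOneOf_surjective N v
  -- pointwise: `(n k) • f = w ∘ conj_g - w` whenever `χ(ḡ) = k`
  have key : ∀ (g : G) (k : ℕ), χ.1 (QuotientGroup.mk g) = (k : ZMod (l ^ i)) →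
      (n * k) • f = (contOneCocycles.pullback (subgroupConj N g)
        (conjRepHom (ContinuousRep.trivial G ℤ (ZMod (l ^ i))).toTopRep N g) w :
          contOneCocycles (((ContinuousRep.trivial G ℤ (ZMod (l ^ i))).restrict (subgroupIncl N)).toTopRep)) - w := by
    intro g k hk
    apply hOneOf_injective N
    have h1 := hv (QuotientGroup.mk g)
    change n • (smulCocycle (hOneRep N (ContinuousRep.trivial G ℤ (ZMod (l ^ i)))) χ (hOneOf N f) _ _).1
        (QuotientGroup.mk g) =
      hOneRep N (ContinuousRep.trivial G ℤ (ZMod (l ^ i))) (QuotientGroup.mk g) (hOneOf N w) - hOneOf N w at h1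
    rw [smulCocycle_apply, hk, torsionSmulHom_natCast, hOneRep_mk_hOneOf] at h1
    rw [hOneOf_nsmul, hOneOf_sub, mul_nsmul']
    exact h1
  -- `w|_K` is conjugation-invariant
  let wK : contOneCocycles
      (((ContinuousRep.trivial G ℤ (ZMod (l ^ i))).restrict (subgroupIncl K)).toTopRep) :=
    ⟨w.1.comp ⟨fun k : K => (⟨k.1, hKN k.2⟩ : N), by fun_prop⟩, fun a b =>
      contOneCocycles.apply_mul_of_trivial (fun _ _ => rfl) w ⟨a.1, hKN a.2⟩ ⟨b.1, hKN b.2⟩⟩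
  have hwK_apply : ∀ k : K, wK.1 k = w.1 ⟨k.1, hKN k.2⟩ := fun _ => rfl
  have hwK : ∀ (g : G) (k : K), wK.1 (subgroupConj K g k) = wK.1 k := by
    intro g k
    obtain ⟨m, hm⟩ := ZMod.natCast_zmod_surjective (χ.1 (QuotientGroup.mk g))
    have h := congrArg (fun u : contOneCocycles
      (((ContinuousRep.trivial G ℤ (ZMod (l ^ i))).restrict (subgroupIncl N)).toTopRep) =>
        u.1 ⟨k.1, hKN k.2⟩) (key g m hm.symm)
    simp only [Submodule.coe_smul_of_tower, ContinuousMap.smul_apply, Submodule.coe_sub,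
      ContinuousMap.sub_apply] at h
    rw [hfK ⟨k.1, hKN k.2⟩ k.2, smul_zero] at h
    -- `h : 0 = w (g⁻¹ k g) - w k`
    rw [hwK_apply, hwK_apply]
    have e1 : (⟨(subgroupConj K g k).1, hKN (subgroupConj K g k).2⟩ : N) =
        subgroupConj N g ⟨k.1, hKN k.2⟩ :=
      Subtype.ext (by rw [subgroupConj_apply_coe, subgroupConj_apply_coe])
    rw [e1]
    exact (sub_eq_zero.1 h.symm)
  have hlcK : ∀ k : K, l ^ c • w.1 ⟨k.1, hKN k.2⟩ = 0 := fun k => by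
    have h : (l ^ c • wK).1 k = 0 := by rw [hK wK hwK]; rfl
    rw [Submodule.coe_smul_of_tower, ContinuousMap.smul_apply] at h
    exact h
  -- `l^c (w(g⁻¹ x g) - w(x)) = 0` for all `g`, `x`
  have hdiff : ∀ (g : G) (x : N), l ^ c • (w.1 (subgroupConj N g x) - w.1 x) = 0 := by
    intro g x
    have hk : (x : G)⁻¹ * (g⁻¹ * x * g) ∈ K := hGK g x x.2
    have e : subgroupConj N g x = x * ⟨(x : G)⁻¹ * (g⁻¹ * x * g), hKN hk⟩ :=
      Subtype.ext (by rw [subgroupConj_apply_coe, Subgroup.coe_mul, mul_inv_cancel_left])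
    rw [e, contOneCocycles.apply_mul_of_trivial (fun _ _ => rfl) w, add_sub_cancel_left]
    exact hlcK ⟨_, hk⟩
  -- evaluate at `n₁`, `g₁`
  obtain ⟨q₁, hq₁⟩ := hχ1
  obtain ⟨g₁, rfl⟩ := QuotientGroup.mk_surjective q₁
  obtain ⟨n₁, hn₁⟩ := hf1
  have hk1 := key g₁ 1 (by rw [hq₁, Nat.cast_one])
  rw [mul_one] at hk1
  have h2 := congrArg (fun u : contOneCocycles
    (((ContinuousRep.trivial G ℤ (ZMod (l ^ i))).restrict (subgroupIncl N)).toTopRep) => l ^ c • u.1 n₁) hk1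
  simp only [Submodule.coe_smul_of_tower, ContinuousMap.smul_apply, Submodule.coe_sub,
    ContinuousMap.sub_apply] at h2
  rw [hn₁, smul_smul] at h2
  -- `h2 : (l^c * n) • 1 = l^c • (w (g₁⁻¹ n₁ g₁) - w n₁)`; the right side vanishes
  have h3 : (l ^ c * n) • (1 : ZMod (l ^ i)) = 0 := h2.trans (hdiff g₁ n₁)
  rw [nsmul_eq_mul, mul_one] at h3
  exact (ZMod.natCast_eq_zero_iff _ _).1 h3

omit [T2Space G] in
/-- **Unbounded order**: under the same datum at every level `i`, for every `n ≥ 1` some class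
`z_i` satisfies `n • z_i ≠ 0` (take `i = c + n`: `l^{c+n} ∤ l^c n` as `n < lⁿ`) — the hypothesis `hord`
of `one_le_deltaInv_two_of_hOneRep_family` / `…_of_isOpen`.
[cite: MochizukiAbsTopI2012, Thm 2.6 (iii) proof p.23] -/
theorem exists_nsmul_hOneRepSmulClass_ne_zero (K : Subgroup G) [K.Normal] (hKN : K ≤ N)
    (hGK : ∀ (g : G) (n : G), n ∈ N → n⁻¹ * (g⁻¹ * n * g) ∈ K) (c : ℕ)
    (hK : ∀ (i : ℕ) (u : contOneCocycles
      (((ContinuousRep.trivial G ℤ (ZMod (l ^ i))).restrict (subgroupIncl K)).toTopRep)),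
      (∀ (g : G) (k : K), u.1 (subgroupConj K g k) = u.1 k) → l ^ c • u = 0)
    (χ : ∀ i : ℕ, contOneCocycles (ContinuousRep.trivial (G ⧸ N) ℤ (ZMod (l ^ i))).toTopRep)
    (hχ1 : ∀ i, ∃ q, (χ i).1 q = 1)
    (f : ∀ i : ℕ, contOneCocycles
      (((ContinuousRep.trivial G ℤ (ZMod (l ^ i))).restrict (subgroupIncl N)).toTopRep))
    (hf : ∀ i (g : G) (n : N), (f i).1 (subgroupConj N g n) = (f i).1 n)
    (hfK : ∀ i (n : N), (n : G) ∈ K → (f i).1 n = 0) (hf1 : ∀ i, ∃ n : N, (f i).1 n = 1)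
    (n : ℕ) (hn : 0 < n) :
    ∃ i, n • hOneRepSmulClass N l i (χ i) (f i) (hf i) ≠ 0 := by
  refine ⟨c + n, fun hz => ?_⟩
  have hdvd := pow_dvd_of_nsmul_hOneRepSmulClass_eq_zero N l (c + n) K hKN hGK c (hK (c + n)) (χ (c + n))
    (hχ1 (c + n)) (f (c + n)) (hf (c + n)) (hfK (c + n)) (hf1 (c + n)) hz
  rw [pow_add] at hdvd
  have hl' : l ^ n ∣ n := (Nat.mul_dvd_mul_iff_left (pow_pos hl.out.pos c)).1 hdvd
  exact absurd (Nat.le_of_dvd hn hl') (not_le.2 (Nat.lt_pow_self hl.out.one_lt))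

end Order

end Literature.NumberTheory.GaloisRepresentations

end
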